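import Mathlib
import HarnessLib.Audit
import Summits.PneNP.PneNP.Theorems.PstarChordReadSlackOne

/-!
# O1 up to thirteen outputs: the typed residual nodes (ROUND-24, O1; memo g22 §19–§21)

FRONTIER range-avoidance ladder, rung F-N3, ROUND 24 (cell `pnp-ideate`, prover-2 memo `g22/O1-PAIRCORE-g22.md` §19–§21; typed target
`PstarCoreBoundTargets.TerminalPeelable` (p646951); restricted-model proof complexity — nothing here bears on `P` versus `NP`).

The chord-read programme (prover-2 g19–g22) proves `TerminalPeelable` (O1) for every terminal core of AT MOST THIRTEEN outputs from two finite
genericity statements about the first centre structures.  This file types them so that they can be cited and closed BY NAME: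

* `TwoGenericTwelve` (H₁₂, OPEN): every twelve-output terminal core at maximal sharing carrying a centre cycle has two distinct slice-generic chords
  (for the menu of its own readers).  KNOWN: by `PstarTerminalPeelableTwelve.sliceGeneric_of_no_pairCore'` it suffices that two chords carry no
  PAIR-CORE; by `PstarPairCoreNormal.PairCore.normalForm` a pair-core is (A) a terminal sub-core `K₀ ⊆ J₀ ∖ c` read by a path sum (`≤ 5` outputs under
  `TerminalFiveA` = O2) or (B) an empty-core coincidence, and (B) is — by `PstarCoincidenceChord` (no chord of `J₀` is folded),
  `PstarCoincidenceMatching` (`≤ 2` AND-components) — the σσ′-pendant NOR mechanism, which the combinatorial census of the 1800 tight structures leaves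
  harmless (110 structures with one affected chord, 1690 with none = the SliceGeneric certificate j314774 exactly; memo §21);
* `ThreeGenericThirteen` (H₁₃, OPEN): every thirteen-output terminal core with `#bdry ≤ 20` carrying a centre cycle has three distinct slice-generic
  chords (such cores have at least seven chords; planner census k = 13 running, V5 so far ≥ 6 generic of 7);
* **`terminalPeelable_le_thirteen`** — `TwoGenericTwelve → ThreeGenericThirteen → (every terminal core with #J₀ ≤ 13 has leaf-peelable non-chords)`
  (`PstarChordReadSlackOne.peelable_of_card_le_thirteen`); `terminalPeelable_le_twelve` — the `k ≤ 12` half from H₁₂ alone.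

Beyond thirteen outputs the non-tight fourteen-output structures have boundary slack two, where shared partners ("hubs") become cost-neutral and
the two-chord theorem needs a hub version (memo §20.2).  No Assumption A anywhere.
-/

set_option linter.dupNamespace false -- `Summit.PneNP.PneNP.…`: summit = sub-problem name (D-0017 single-conjunct layout)

open Finset Literature.Computability.Complexity
open Summit.PneNP.PneNP.Theorems.PstarTyped (Typed)
open Summit.PneNP.PneNP.Theorems.PstarSALevel (bdry BoundaryExpanding SimpleOverlap)
open Summit.PneNP.PneNP.Theorems.PstarXCore (xverts)
open Summit.PneNP.PneNP.Theorems.PstarChordRepair (IsChord)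
open Summit.PneNP.PneNP.Theorems.PstarCoreBoundTargets (Terminal nonchords)
open Summit.PneNP.PneNP.Theorems.PstarSharingBound (sharedSlots)
open Summit.PneNP.PneNP.Theorems.PstarChordBridgeTools (xpdeg)
open Summit.PneNP.PneNP.Theorems.PstarChordBridgeCotree (Peelable)
open Summit.PneNP.PneNP.Theorems.PstarChordReadLemma (SliceGeneric)
open Summit.PneNP.PneNP.Theorems.PstarTerminalPeelableTwelve (peelable_of_card_le_twelve)
open Summit.PneNP.PneNP.Theorems.PstarChordReadSlackOne (peelable_of_card_le_thirteen)

namespace Summit.PneNP.PneNP.Theorems.PstarTerminalPeelableResidual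

/-- **H₁₂ (OPEN): two slice-generic chords on every tight twelve-output centre structure.**  For every pure typed `(r,3/2)`-expanding instance with
simple overlaps and every terminal core `(J₀, w₁, w₂)` with `#J₀ = 12` at maximal sharing (`2·#sharedSlots = #J₀`) carrying a non-empty leafless
set of non-chords (a centre cycle), there are two distinct chords of `J₀` that are slice-generic for the menu `G₁ ∪ G₂`.  Sufficient (pair-core form):
two chords with no pair-core inside `J₀ ∖ c` (`PstarTerminalPeelableTwelve.peelable_of_card_le_twelve_of_noPairCore`).  FRONTIER. -/
@[conjecture] def TwoGenericTwelve : Prop :=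
  ∀ (n m r : ℕ) (I : LocalMap 4 n m), I.IsPure xorAndPred → Typed I → SimpleOverlap I → BoundaryExpanding r I →
    ∀ (y : Fin m → Bool) (J₀ : Finset (Fin m)) (w₁ w₂ : Finset (Fin n) × Finset (Fin m) × Bool), Terminal I r y J₀ w₁ w₂ →
      J₀.card = 12 → 2 * (sharedSlots I J₀).card = J₀.card →
      (∃ S ⊆ J₀, S.Nonempty ∧ (∀ w ∈ xverts I S, 2 ≤ xpdeg I S w) ∧ ∀ f ∈ S, ¬ IsChord I J₀ f) →
      ∃ cᵢ ∈ J₀, ∃ cⱼ ∈ J₀, cᵢ ≠ cⱼ ∧ IsChord I J₀ cᵢ ∧ IsChord I J₀ cⱼ ∧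
        SliceGeneric I y J₀ cᵢ (w₁.2.1 ∪ w₂.2.1) ∧ SliceGeneric I y J₀ cⱼ (w₁.2.1 ∪ w₂.2.1)

/-- **H₁₃ (OPEN): three slice-generic chords on every thirteen-output centre structure.**  For every terminal core with `#J₀ = 13`, boundary slack at
most one (`2·#bdry J₀ ≤ 3·#J₀ + 1`, automatic with a centre cycle: `PstarChordReadSlackOne.slackOne_of_centre_thirteen`) and a centre cycle, there are
three distinct slice-generic chords.  FRONTIER. -/
@[conjecture] def ThreeGenericThirteen : Prop :=
  ∀ (n m r : ℕ) (I : LocalMap 4 n m), I.IsPure xorAndPred → Typed I → SimpleOverlap I → BoundaryExpanding r I →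
    ∀ (y : Fin m → Bool) (J₀ : Finset (Fin m)) (w₁ w₂ : Finset (Fin n) × Finset (Fin m) × Bool), Terminal I r y J₀ w₁ w₂ →
      J₀.card = 13 → 2 * (bdry I J₀).card ≤ 3 * J₀.card + 1 →
      (∃ S ⊆ J₀, S.Nonempty ∧ (∀ w ∈ xverts I S, 2 ≤ xpdeg I S w) ∧ ∀ f ∈ S, ¬ IsChord I J₀ f) →
      ∃ c₁ ∈ J₀, ∃ c₂ ∈ J₀, ∃ c₃ ∈ J₀, c₁ ≠ c₂ ∧ c₁ ≠ c₃ ∧ c₂ ≠ c₃ ∧ IsChord I J₀ c₁ ∧ IsChord I J₀ c₂ ∧ IsChord I J₀ c₃ ∧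
        SliceGeneric I y J₀ c₁ (w₁.2.1 ∪ w₂.2.1) ∧ SliceGeneric I y J₀ c₂ (w₁.2.1 ∪ w₂.2.1) ∧ SliceGeneric I y J₀ c₃ (w₁.2.1 ∪ w₂.2.1)

/-- **O1 FOR TERMINAL CORES OF AT MOST TWELVE OUTPUTS from H₁₂.** -/
theorem terminalPeelable_le_twelve (h₁₂ : TwoGenericTwelve) :
    ∀ (n m r : ℕ) (I : LocalMap 4 n m), I.IsPure xorAndPred → Typed I → SimpleOverlap I → BoundaryExpanding r I →
      ∀ (y : Fin m → Bool) (J₀ : Finset (Fin m)) (w₁ w₂ : Finset (Fin n) × Finset (Fin m) × Bool), Terminal I r y J₀ w₁ w₂ →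
        J₀.card ≤ 12 → Peelable I (nonchords I J₀) :=
  fun n m r I hI hT hS hB _ _ _ _ ht hk => peelable_of_card_le_twelve hI hT hS hB (h₁₂ n m r I hI hT hS hB) ht hk

/-- **O1 FOR TERMINAL CORES OF AT MOST THIRTEEN OUTPUTS from H₁₂ and H₁₃.** -/
theorem terminalPeelable_le_thirteen (h₁₂ : TwoGenericTwelve) (h₁₃ : ThreeGenericThirteen) :
    ∀ (n m r : ℕ) (I : LocalMap 4 n m), I.IsPure xorAndPred → Typed I → SimpleOverlap I → BoundaryExpanding r I →
      ∀ (y : Fin m → Bool) (J₀ : Finset (Fin m)) (w₁ w₂ : Finset (Fin n) × Finset (Fin m) × Bool), Terminal I r y J₀ w₁ w₂ →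
        J₀.card ≤ 13 → Peelable I (nonchords I J₀) :=
  fun n m r I hI hT hS hB _ _ _ _ ht hk =>
    peelable_of_card_le_thirteen hI hT hS hB (h₁₂ n m r I hI hT hS hB) (h₁₃ n m r I hI hT hS hB) ht hk

end Summit.PneNP.PneNP.Theorems.PstarTerminalPeelableResidual
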